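import Mathlib.Algebra.Polynomial.Roots
import Mathlib.Tactic.LinearCombination
import Mathlib.Tactic.IntervalCases
import HarnessLib

/-!
# Venture HSemireg — WEIGHT HOMOGENEITY: an equivariant polynomial of weight `m` in an argument of weight `d` vanishes unless `d ∣ m`

The mechanism of [LekiliPerutz2012ArithmeticMirror2Torus, Lemma 5.3] (arXiv:1211.4632v1, p. 46
L69–76; a PREPRINT — see the status words below) in kernel form, typed by the literature seat
lit-w-polishchuk-orlov (g11) after the ×2 ACROSS SEATS read of the W1 arity-8 locator
(`widen/LIT-W/LITW-READ-LEKILI-PERUTZ-AINF-litwpo-g11.md`; companion of `RootWeightLaw.lean`, the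
cyclic-character version, and of `ModularWeightCMVanishing.lean`, the modular-weight version).

SETTING AS PRINTED. [LekiliPerutz2012ArithmeticMirror2Torus, Thm C (1), p. 42 L22–28]: the minimal
`A∞`-structures `𝒜_w = (A, μ•_w)` of the embedded Weierstrass curves `C_w`,
`w = (a₁, a₂, a₃, a₄, a₆) ∈ W = Spec 𝕂[a₁, …, a₆]`, obtained from the Čech model by the homological
perturbation lemma with an equivariant splitting, «depend polynomially on `w ∈ W`, and are
`𝕂^×`-equivariant, meaning that `μ^d_{t·w} = t^{d−2} μ^d_w`»; the weights are «`τ · a_j = τ^{−j} a_j`»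
(p. 17 L19–20); and [Lemma 5.3, p. 46]: «Pick `i > 2` and `(a₁, …, a_i) ∈ A`. The map `p : W_d → 𝕂`
given by `w ↦ μ^i_w(a₁, …, a_i)` is zero except when `i − 2` is a multiple of `d`. It is linear if
`i = d + 2`, and in general is homogeneous of degree `(i − 2)/d`.» with the one-line proof «The map
`p` is a polynomial function, equivariant under `𝕂^×`, meaning that `p(ε^d w) = ε^{i−2} p(w)`, and is
therefore homogeneous, of degree `(i − 2)/d`.» (REFEREED neighbours printing the same weight law:
[LekiliPerutz2011FukayaTorusDehnSurgery, Thm 5 (3)] «`μ^d_{t𝒜′} = t^{d−2} μ^d_{𝒜′}` corresponds to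
the action `t · (a, b) = (t⁴ a, t⁶ b)`»; [LekiliPolishchuk2019ModularCompactificationM1n,
Lemma 2.1.2 (i)] «`(μ_n) ↦ (λ^{n−2} μ_n)`».)

WHAT IS PROVED (elementary polynomial algebra; DERIVED statements, labelled so — the content of the
printed one-line proof, made unconditional in two ways). A polynomial `P ∈ R[X]` in ONE variable
(the coordinate `a_d` of the weight line `W_d`) is called here *equivariant of weight `m` for an
argument of weight `d`* when `P(c^d X) = c^m P(X)`:
* `coeff_eq_zero_of_formally_equivariant` — over ANY commutative ring, if the identity holds with a
  FORMAL scalar `c = T` (i.e. in `R[T][X]`, which is what an algebraic `𝔾_m`-action gives), then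
  every coefficient of `P` in a degree `k` with `d k ≠ m` vanishes; hence `P = 0` if `d ∤ m`
  (`eq_zero_of_formally_equivariant`) and `P` is the monomial `P_k X^k`, `d k = m`, otherwise
  (`eq_monomial_of_formally_equivariant`; «homogeneous of degree `m/d`», «linear if `m = d`»);
* `coeff_eq_zero_of_equivariant` — over an integral domain, the same conclusions when the identity
  is only assumed for the scalars `c` of an INFINITE set `S ⊆ R` (e.g. the units of an infinite
  field), via «a non-zero polynomial has finitely many roots» applied to `X^{dk} − X^m`; with the
  pointwise form `P(c^d x) = c^m P(x)` for all `x` as `coeff_eq_zero_of_eval_equivariant`;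
* `monomial_formally_equivariant` ∕ `monomial_equivariant` — NON-VACUITY ∕ converse: the monomials
  `a X^k` do satisfy the hypothesis (with `m = d k`), so the statements above are sharp;
* the ARITY BOOKKEEPING the cell uses (`m = i − 2`, one statement per weight line), for a family
  `P i` of such polynomials: on the weight-`6` line (`E_ω : y² = x³ + a₆`, `w ∈ W₆`)
  `P 3 = P 4 = P 5 = P 6 = P 7 = 0`, `P 8` is LINEAR, `P 9 = ⋯ = P 13 = 0`, `P 14` is a multiple of
  `X²` (`weightSixLine_vanishing`, `weightSixLine_arity_eight_linear`, …); on the weight-`4` line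
  (`E_i : y² = x³ + a₄ x`) `P 3 = P 4 = P 5 = 0` and `P 6` is linear; in general `P i = 0` unless
  `i ≡ 2 (mod d)` (`eq_zero_of_not_modEq_two`).

NOT PROVED HERE (and not claimed): that `μ⁸` (resp. `μ⁶`) is NON-ZERO — in print that is
[LekiliPerutz2012ArithmeticMirror2Torus, Thm 5.5] (`[κ¹] : coker d ⥲ HH²(A,A)^{≤0}`, deformation
theory) resp. [LekiliPerutz2011FukayaTorusDehnSurgery, Prop 9]; nor anything about `μ¹⁴, μ²⁰, …`
beyond homogeneity (their non-vanishing is not printed anywhere; read file (E2) / sheet (J12)).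
HONEST FRAMING: one-variable polynomial algebra only; no curve, `A∞`-structure, Hochschild complex,
sheaf or semiregularity map is constructed here — polynomiality and equivariance enter as
hypotheses on an abstract polynomial; nothing here says that HC, HC_CM or HC_AV holds, and nothing
here is a new case of anything.
-/

namespace Summit.Ventures.HSemireg

namespace WeightHomogeneity

open Polynomial

/-! ### Formal equivariance (any commutative ring): the scalar is a variable `T` -/

section Formal

variable {R : Type*} [CommRing R]

/-- **Weight mismatch kills a coefficient (formal scalar).** If `P(T^d X) = T^m P(X)` in `R[T][X]`
(`P` with constant coefficients, `T` the variable of the scalar ring `R[T]`), then `P_k = 0`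
whenever `d k ≠ m`. [DERIVED; the formal-variable form of LP12 Lemma 5.3's proof line] -/
theorem coeff_eq_zero_of_formally_equivariant (P : R[X]) (d m : ℕ)
    (h : (P.map (C : R →+* R[X])).comp (C ((X : R[X]) ^ d) * X) =
      C ((X : R[X]) ^ m) * P.map (C : R →+* R[X]))
    (k : ℕ) (hk : d * k ≠ m) : P.coeff k = 0 := by
  have hc := congrArg (fun Q : R[X][X] => Q.coeff k) h
  simp only [comp_C_mul_X_coeff, coeff_map, coeff_C_mul] at hc
  -- hc : C (P.coeff k) * (X ^ d) ^ k = X ^ m * C (P.coeff k)   (in R[X])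
  have hc' := congrArg (fun q : R[X] => q.coeff (d * k)) hc
  simp only [← pow_mul, coeff_C_mul, coeff_X_pow, if_true, mul_one] at hc'
  rw [mul_comm (X ^ m) _, coeff_C_mul, coeff_X_pow, if_neg hk, mul_zero] at hc'
  exact hc'

/-- If moreover `d ∤ m`, the polynomial vanishes identically. [DERIVED] -/
theorem eq_zero_of_formally_equivariant (P : R[X]) {d m : ℕ} (hdm : ¬ d ∣ m)
    (h : (P.map (C : R →+* R[X])).comp (C ((X : R[X]) ^ d) * X) =
      C ((X : R[X]) ^ m) * P.map (C : R →+* R[X])) : P = 0 := by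
  ext k
  rw [coeff_zero]
  refine coeff_eq_zero_of_formally_equivariant P d m h k ?_
  rintro rfl
  exact hdm (dvd_mul_right d k)

/-- If `d k = m` (and `d ≠ 0`), the polynomial is the single monomial `P_k X^k`: «homogeneous of
degree `m / d`», in particular LINEAR when `m = d`. [DERIVED] -/
theorem eq_monomial_of_formally_equivariant (P : R[X]) {d m k : ℕ} (hd : d ≠ 0) (hkm : d * k = m)
    (h : (P.map (C : R →+* R[X])).comp (C ((X : R[X]) ^ d) * X) =
      C ((X : R[X]) ^ m) * P.map (C : R →+* R[X])) : P = C (P.coeff k) * X ^ k := by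
  ext j
  rw [coeff_C_mul, coeff_X_pow]
  by_cases hj : j = k
  · subst hj; simp
  · rw [if_neg hj, mul_zero]
    refine coeff_eq_zero_of_formally_equivariant P d m h j ?_
    intro hdj
    apply hj
    have : d * j = d * k := by rw [hdj, hkm]
    exact Nat.eq_of_mul_eq_mul_left (Nat.pos_of_ne_zero hd) this

/-- **Non-vacuity ∕ converse.** A monomial `a X^k` IS formally equivariant, of weight `d k`: the
hypothesis of the three statements above is satisfied exactly by the monomials they single out.
[DERIVED] -/
theorem monomial_formally_equivariant (a : R) (d k : ℕ) :
    ((C a * X ^ k).map (C : R →+* R[X])).comp (C ((X : R[X]) ^ d) * X) =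
      C ((X : R[X]) ^ (d * k)) * (C a * X ^ k).map (C : R →+* R[X]) := by
  simp only [Polynomial.map_mul, Polynomial.map_pow, map_C, map_X, mul_comp, C_comp, pow_comp,
    X_comp]
  rw [mul_pow, ← C_pow, ← pow_mul]
  ring

end Formal

/-! ### Pointwise equivariance on an infinite set of scalars (integral domain) -/

section Pointwise

variable {R : Type*} [CommRing R] [IsDomain R]

/-- The one-coefficient core: if `a c^e = c^m a` for all scalars `c` of an infinite set and
`e ≠ m`, then `a = 0` — because `X^e − X^m ≠ 0` has only finitely many roots. [DERIVED] -/
theorem eq_zero_of_pow_weight_mismatch {S : Set R} (hS : S.Infinite) {a : R} {e m : ℕ}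
    (hem : e ≠ m) (h : ∀ c ∈ S, a * c ^ e = c ^ m * a) : a = 0 := by
  by_contra ha
  have hQ : (X ^ e - X ^ m : R[X]) ≠ 0 := by
    intro h0
    have h1 := congrArg (fun q : R[X] => q.coeff e) h0
    simp only [coeff_sub, coeff_X_pow, if_true, coeff_zero] at h1
    rw [if_neg hem, sub_zero] at h1
    exact one_ne_zero h1
  refine hQ (eq_zero_of_infinite_isRoot _ (hS.mono ?_))
  intro c hc
  simp only [Set.mem_setOf_eq, IsRoot.def, eval_sub, eval_pow, eval_X]
  have h2 : a * (c ^ e - c ^ m) = 0 := by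
    rw [mul_sub, h c hc, mul_comm (c ^ m) a, sub_self]
  rcases mul_eq_zero.mp h2 with h3 | h3
  · exact absurd h3 ha
  · exact h3

/-- **Weight mismatch kills a coefficient (pointwise scalars).** If `P(c^d X) = c^m P(X)` in `R[X]`
for every `c` in an infinite set `S` of scalars of an integral domain `R`, then `P_k = 0` whenever
`d k ≠ m`. [DERIVED; LP12 Lemma 5.3's proof line with «`𝕂^×`-equivariant» read pointwise] -/
theorem coeff_eq_zero_of_equivariant (P : R[X]) (d m : ℕ) {S : Set R} (hS : S.Infinite)
    (h : ∀ c ∈ S, P.comp (C (c ^ d) * X) = C (c ^ m) * P) (k : ℕ) (hk : d * k ≠ m) :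
    P.coeff k = 0 := by
  refine eq_zero_of_pow_weight_mismatch hS hk fun c hc => ?_
  have hc' := congrArg (fun Q : R[X] => Q.coeff k) (h c hc)
  simp only [comp_C_mul_X_coeff, coeff_C_mul, ← pow_mul] at hc'
  exact hc'

/-- Pointwise-in-`x` form: `P(c^d x) = c^m P(x)` for all `x ∈ R` and all `c` in an infinite set
`S ⊆ R` (so `R` is infinite) forces `P_k = 0` whenever `d k ≠ m`. [DERIVED] -/
theorem coeff_eq_zero_of_eval_equivariant (P : R[X]) (d m : ℕ) {S : Set R} (hS : S.Infinite)
    (h : ∀ c ∈ S, ∀ x : R, P.eval (c ^ d * x) = c ^ m * P.eval x) (k : ℕ) (hk : d * k ≠ m) :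
    P.coeff k = 0 := by
  haveI := hS.to_subtype
  haveI : Infinite R := Infinite.of_injective (Subtype.val : S → R) Subtype.val_injective
  refine coeff_eq_zero_of_equivariant P d m hS (fun c hc => ?_) k hk
  apply Polynomial.funext
  intro x
  rw [eval_comp, eval_mul, eval_C, eval_X, eval_mul, eval_C, h c hc x]

/-- `d ∤ m` ⇒ `P = 0` (pointwise scalars). [DERIVED] -/
theorem eq_zero_of_equivariant (P : R[X]) {d m : ℕ} (hdm : ¬ d ∣ m) {S : Set R} (hS : S.Infinite)
    (h : ∀ c ∈ S, P.comp (C (c ^ d) * X) = C (c ^ m) * P) : P = 0 := by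
  ext k
  rw [coeff_zero]
  refine coeff_eq_zero_of_equivariant P d m hS h k ?_
  rintro rfl
  exact hdm (dvd_mul_right d k)

/-- `d k = m`, `d ≠ 0` ⇒ `P = P_k X^k` (pointwise scalars): «homogeneous of degree `m/d`». [DERIVED] -/
theorem eq_monomial_of_equivariant (P : R[X]) {d m k : ℕ} (hd : d ≠ 0) (hkm : d * k = m)
    {S : Set R} (hS : S.Infinite) (h : ∀ c ∈ S, P.comp (C (c ^ d) * X) = C (c ^ m) * P) :
    P = C (P.coeff k) * X ^ k := by
  ext j
  rw [coeff_C_mul, coeff_X_pow]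
  by_cases hj : j = k
  · subst hj; simp
  · rw [if_neg hj, mul_zero]
    refine coeff_eq_zero_of_equivariant P d m hS h j ?_
    intro hdj
    apply hj
    have : d * j = d * k := by rw [hdj, hkm]
    exact Nat.eq_of_mul_eq_mul_left (Nat.pos_of_ne_zero hd) this

omit [IsDomain R] in
/-- **Non-vacuity ∕ converse (pointwise).** `a X^k` satisfies `P(c^d X) = c^{dk} P(X)` for every
scalar `c`. [DERIVED] -/
theorem monomial_equivariant (a c : R) (d k : ℕ) :
    (C a * X ^ k).comp (C (c ^ d) * X) = C (c ^ (d * k)) * (C a * X ^ k) := by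
  simp only [mul_comp, C_comp, pow_comp, X_comp]
  rw [mul_pow, ← C_pow, ← pow_mul]
  ring

end Pointwise

/-! ### Arity bookkeeping on one weight line (`m = i − 2`): the sentences the cell uses -/

section Arity

variable {R : Type*} [CommRing R]

/-- **Arities off `2 + dℕ` carry nothing.** For a family `P i` (`i > 2`) of polynomials on the
weight-`d` line, formally equivariant of weight `i − 2`, `P i = 0` unless `i ≡ 2 (mod d)`.
[DERIVED — LP12 Lemma 5.3 «zero except when `i − 2` is a multiple of `d`»] -/
theorem eq_zero_of_not_modEq_two (d : ℕ) (P : ℕ → R[X])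
    (hP : ∀ i, 2 < i → ((P i).map (C : R →+* R[X])).comp (C ((X : R[X]) ^ d) * X) =
      C ((X : R[X]) ^ (i - 2)) * (P i).map (C : R →+* R[X]))
    (i : ℕ) (hi : 2 < i) (hmod : ¬ i ≡ 2 [MOD d]) : P i = 0 := by
  refine eq_zero_of_formally_equivariant (P i) (fun hdvd => hmod ?_) (hP i hi)
  exact ((Nat.modEq_iff_dvd' hi.le).mpr hdvd).symm

/-- **The weight-`6` line** (`E_ω : y² = x³ + a₆`; `w ∈ W₆`): `μ³ = μ⁴ = μ⁵ = μ⁶ = μ⁷ = 0` and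
`μ⁹ = ⋯ = μ¹³ = 0` on that line — every arity `2 < i < 14` other than `8`. [DERIVED] -/
theorem weightSixLine_vanishing (P : ℕ → R[X])
    (hP : ∀ i, 2 < i → ((P i).map (C : R →+* R[X])).comp (C ((X : R[X]) ^ 6) * X) =
      C ((X : R[X]) ^ (i - 2)) * (P i).map (C : R →+* R[X]))
    (i : ℕ) (hi : 2 < i) (hi' : i < 14) (h8 : i ≠ 8) : P i = 0 := by
  refine eq_zero_of_not_modEq_two 6 P hP i hi ?_
  intro hmod
  rw [Nat.ModEq] at hmod
  interval_cases i <;> omega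

/-- **The weight-`6` line, arity `8`:** `μ⁸` is LINEAR in `a₆` («It is linear if `i = d + 2`»).
[DERIVED] -/
theorem weightSixLine_arity_eight_linear (P : ℕ → R[X])
    (hP : ∀ i, 2 < i → ((P i).map (C : R →+* R[X])).comp (C ((X : R[X]) ^ 6) * X) =
      C ((X : R[X]) ^ (i - 2)) * (P i).map (C : R →+* R[X])) :
    P 8 = C ((P 8).coeff 1) * X := by
  have h := eq_monomial_of_formally_equivariant (P 8) (d := 6) (m := 8 - 2) (k := 1)
    (by norm_num) (by norm_num) (hP 8 (by norm_num))
  simpa using h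

/-- **The weight-`6` line, arity `14`:** `μ¹⁴` is a multiple of `a₆²` (homogeneous of degree
`(14 − 2)/6 = 2`; whether it is zero is NOT decided by the weight law). [DERIVED] -/
theorem weightSixLine_arity_fourteen_quadratic (P : ℕ → R[X])
    (hP : ∀ i, 2 < i → ((P i).map (C : R →+* R[X])).comp (C ((X : R[X]) ^ 6) * X) =
      C ((X : R[X]) ^ (i - 2)) * (P i).map (C : R →+* R[X])) :
    P 14 = C ((P 14).coeff 2) * X ^ 2 :=
  eq_monomial_of_formally_equivariant (P 14) (d := 6) (m := 14 - 2) (k := 2)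
    (by norm_num) (by norm_num) (hP 14 (by norm_num))

/-- **The weight-`4` line** (`E_i : y² = x³ + a₄ x`; `w ∈ W₄`): `μ³ = μ⁴ = μ⁵ = 0` on that line,
and `μ⁷ = μ⁸ = μ⁹ = 0` — every arity `2 < i < 10` other than `6`. [DERIVED] -/
theorem weightFourLine_vanishing (P : ℕ → R[X])
    (hP : ∀ i, 2 < i → ((P i).map (C : R →+* R[X])).comp (C ((X : R[X]) ^ 4) * X) =
      C ((X : R[X]) ^ (i - 2)) * (P i).map (C : R →+* R[X]))
    (i : ℕ) (hi : 2 < i) (hi' : i < 10) (h6 : i ≠ 6) : P i = 0 := by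
  refine eq_zero_of_not_modEq_two 4 P hP i hi ?_
  intro hmod
  rw [Nat.ModEq] at hmod
  interval_cases i <;> omega

/-- **The weight-`4` line, arity `6`:** `μ⁶` is LINEAR in `a₄`. [DERIVED] -/
theorem weightFourLine_arity_six_linear (P : ℕ → R[X])
    (hP : ∀ i, 2 < i → ((P i).map (C : R →+* R[X])).comp (C ((X : R[X]) ^ 4) * X) =
      C ((X : R[X]) ^ (i - 2)) * (P i).map (C : R →+* R[X])) :
    P 6 = C ((P 6).coeff 1) * X := by
  have h := eq_monomial_of_formally_equivariant (P 6) (d := 4) (m := 6 - 2) (k := 1)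
    (by norm_num) (by norm_num) (hP 6 (by norm_num))
  simpa using h

end Arity

end WeightHomogeneity

end Summit.Ventures.HSemireg
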